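import Mathlib
import Literature.Combinatorics.Optimization.PsdMinimalPolytopes
import Literature.Barriers.PneNP.ExtendedFormulationFaceCounting
import HarnessLib

/-!
# Every convex `n`-gon has extension complexity at least `log₂(2n+2)` (Fiorini–Rothvoß–Tiwary 2012, §1)

Source: S. Fiorini, T. Rothvoß, H. R. Tiwary, *Extended formulations for polygons*, DCG 48 (2012) =
arXiv:1107.0371 [FioriniRothvossTiwary2012], §1 (p03, verbatim): "Notice that the extension
complexity of every `n`-gon is `Ω(log n)`. This follows from the fact that any extension `Q` with `k`
facets has at most `2^k` faces. Since each face of `P` is the projection of a face of the extension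
`Q`, it follows that `Q` must have at least `log₂ f` facets if `P` has `f` faces [Goemans09]. Thus if
`P` is an `n`-gon, we have `xc(P) ≥ log₂(2n+2) = Ω(log n)`. When `P` is a regular `n`-gon, we have
`xc(P) = Θ(log n)`."

What this file PROVES (namespace `Literature.Combinatorics.Optimization`; polygons = the tree's
`IsConvexPolygon x` (`x : Fin m → ℝ²` the vertices in cyclic order, `PsdMinimalPolytopes.lean`);
EFs = the tree's slack-form `Literature.Barriers.PneNP.HasEFOfSize`; the face bound = the tree's
`HasEFOfSize.natCard_faces_le`, Goemans' Theorem 1, `ExtendedFormulationFaceCounting.lean`):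
* `IsConvexPolygon.injective`, `IsConvexPolygon.mem_extremePoints` — the listed vertices are
  distinct and are extreme points of the polygon (vertex `x_{j+1}` is the unique maximiser of the sum
  of the two incident edge normals);
* `IsConvexPolygon.isExtreme_edge` — the `m` edges `{y ∈ P : a_jᵀ y = b_j}` are (exposed, hence)
  extreme convex subsets containing exactly the vertices `x_j, x_{j+1}`;
* `IsConvexPolygon.two_mul_add_one_le_natCard_faces` — a convex `m`-gon (`m ≥ 3`) has at least
  `2m + 1` nonempty faces (vertices, edges, itself);
* **`IsConvexPolygon.two_mul_add_two_le_two_pow`** — hence every extended formulation with `r`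
  inequalities has `2m + 2 ≤ 2^r` (the printed `xc(P) ≥ log₂(2n+2)`; `2m+1 ≤ 2^r` and parity), and
  the logarithmic form `FioriniRothvossTiwary2012_xc_ge_logb`.
-/

noncomputable section

open Set

namespace Literature.Combinatorics.Optimization

open Literature.Barriers.PneNP

variable {n : ℕ}

/-! ### Index bookkeeping on `Fin (n+1)` -/

/-- `j + 1 ≠ j` once `n + 1 ≥ 2`. [folklore] -/
private theorem add_one_ne (hn : 1 ≤ n) (j : Fin (n + 1)) : j + 1 ≠ j := by
  intro h
  have hv := congrArg Fin.val h
  have e1 : ((j + 1 : Fin (n + 1)) : ℕ) = if j = Fin.last n then 0 else (j : ℕ) + 1 :=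
    Fin.val_add_one j
  have hl : ((Fin.last n : Fin (n + 1)) : ℕ) = n := Fin.val_last n
  by_cases hA : j = Fin.last n
  · have hjv : (j : ℕ) = n := by rw [hA, hl]
    rw [if_pos hA] at e1
    omega
  · rw [if_neg hA] at e1
    omega

/-- `j + 2 ≠ j` once `n + 1 ≥ 3`. [folklore] -/
private theorem add_two_ne (hn : 2 ≤ n) (j : Fin (n + 1)) : j + 1 + 1 ≠ j := by
  intro h
  have hv := congrArg Fin.val h
  have e1 : ((j + 1 : Fin (n + 1)) : ℕ) = if j = Fin.last n then 0 else (j : ℕ) + 1 :=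
    Fin.val_add_one j
  have e2 : ((j + 1 + 1 : Fin (n + 1)) : ℕ) =
      if j + 1 = Fin.last n then 0 else ((j + 1 : Fin (n + 1)) : ℕ) + 1 := Fin.val_add_one (j + 1)
  have hl : ((Fin.last n : Fin (n + 1)) : ℕ) = n := Fin.val_last n
  by_cases hA : j = Fin.last n
  · have hjv : (j : ℕ) = n := by rw [hA, hl]
    rw [if_pos hA] at e1
    by_cases hB : j + 1 = Fin.last n
    · have h3 := congrArg Fin.val hB
      rw [e1, hl] at h3
      omega
    · rw [if_neg hB, e1] at e2
      omega
  · rw [if_neg hA] at e1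
    by_cases hB : j + 1 = Fin.last n
    · have h3 := congrArg Fin.val hB
      rw [e1, hl] at h3
      rw [if_pos hB] at e2
      omega
    · rw [if_neg hB, e1] at e2
      omega

variable {x : Fin (n + 1) → (Fin 2 → ℝ)}

/-- Slack of vertex `i` in edge `j` = the `(i, j)` entry of the polygon slack matrix. [cite: FioriniRothvossTiwary2012, §2 (p04, "`S_{ij} = b_i − A_i v_j`")] -/
private theorem offset_sub_dotProduct_vertex (x : Fin (n + 1) → (Fin 2 → ℝ)) (i j : Fin (n + 1)) :
    polygonOffset x j - polygonNormal x j ⬝ᵥ x i = polygonSlack x i j := by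
  have h := congrFun (congrFun (pairSlackMatrix_polygon x) i) j
  rwa [pairSlackMatrix_apply] at h

/-- **The listed vertices of a convex polygon are distinct.** [cite: FioriniRothvossTiwary2012, §1 (p03, "`n`-gon")] -/
theorem IsConvexPolygon.injective (hx : IsConvexPolygon x) (hn : 2 ≤ n) : Function.Injective x := by
  intro i i' h
  by_contra hne
  have h1 : polygonSlack x i' i = 0 := by
    rw [← offset_sub_dotProduct_vertex, ← h, offset_sub_dotProduct_vertex]
    exact (hx.eq_zero_iff i i).2 (Or.inl rfl)
  have h2 : polygonSlack x i i' = 0 := by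
    rw [← offset_sub_dotProduct_vertex, h, offset_sub_dotProduct_vertex]
    exact (hx.eq_zero_iff i' i').2 (Or.inl rfl)
  rcases (hx.eq_zero_iff i' i).1 h1 with h1 | h1
  · exact hne h1.symm
  rcases (hx.eq_zero_iff i i').1 h2 with h2 | h2
  · exact hne h2
  rw [h2] at h1
  exact add_two_ne hn i' h1.symm

/-- **The listed vertices are extreme points**: `x_{j+1}` is the unique maximiser over the vertices of
`a_j + a_{j+1}` (the sum of the normals of its two edges), hence an extreme point of the hull (tree:
`mem_extremePoints_convexHull_of_dotProduct_lt`). [cite: FioriniRothvossTiwary2012, §1 (p03, "if `P` is an `n`-gon")] -/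
theorem IsConvexPolygon.mem_extremePoints (hx : IsConvexPolygon x) (hn : 2 ≤ n) (i : Fin (n + 1)) :
    x i ∈ (convexHull ℝ (Set.range x)).extremePoints ℝ := by
  -- write `i = j + 1`
  obtain ⟨j, rfl⟩ : ∃ j, i = j + 1 := ⟨i - 1, (sub_add_cancel i 1).symm⟩
  refine mem_extremePoints_convexHull_of_dotProduct_lt (c := polygonNormal x j + polygonNormal x (j + 1))
    (Set.mem_range_self _) ?_
  rintro _ ⟨q, rfl⟩ hq
  have hqj : q ≠ j + 1 := fun h => hq (by rw [h])
  rw [add_dotProduct, add_dotProduct]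
  have s1 := offset_sub_dotProduct_vertex x q j
  have s2 := offset_sub_dotProduct_vertex x q (j + 1)
  have t1 := offset_sub_dotProduct_vertex x (j + 1) j
  have t2 := offset_sub_dotProduct_vertex x (j + 1) (j + 1)
  rw [(hx.eq_zero_iff _ _).2 (Or.inr rfl)] at t1
  rw [(hx.eq_zero_iff _ _).2 (Or.inl rfl)] at t2
  have hq1 := hx.nonneg q j
  have hq2 := hx.nonneg q (j + 1)
  -- not both slacks vanish
  have hpos : 0 < polygonSlack x q j + polygonSlack x q (j + 1) := by
    rcases (hq1.lt_or_eq) with h | h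
    · linarith
    rcases (hq2.lt_or_eq) with h' | h'
    · linarith
    exfalso
    rcases (hx.eq_zero_iff q j).1 h.symm with h3 | h3
    · rcases (hx.eq_zero_iff q (j + 1)).1 h'.symm with h4 | h4
      · exact hqj h4
      · rw [h3] at h4; exact add_two_ne hn j h4.symm
    · exact hqj h3
  linarith

/-- The `j`-th edge `{y ∈ P : a_jᵀ y = b_j}` of the polygon `P = conv{x_i}`. [cite: FioriniRothvossTiwary2012, §1 (p03, "each face of `P`")] -/
def polygonEdge (x : Fin (n + 1) → (Fin 2 → ℝ)) (j : Fin (n + 1)) : Set (Fin 2 → ℝ) :=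
  convexHull ℝ (Set.range x) ∩ {y | polygonNormal x j ⬝ᵥ y = polygonOffset x j}

/-- Membership in an edge. [cite: FioriniRothvossTiwary2012, §1 (p03)] -/
theorem mem_polygonEdge {j : Fin (n + 1)} {y : Fin 2 → ℝ} :
    y ∈ polygonEdge x j ↔
      y ∈ convexHull ℝ (Set.range x) ∧ polygonNormal x j ⬝ᵥ y = polygonOffset x j := Iff.rfl

/-- A vertex lies on edge `j` iff it is `x_j` or `x_{j+1}`. [cite: FioriniRothvossTiwary2012, §1 (p03)] -/
theorem IsConvexPolygon.vertex_mem_polygonEdge_iff (hx : IsConvexPolygon x) (i j : Fin (n + 1)) :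
    x i ∈ polygonEdge x j ↔ i = j ∨ i = j + 1 := by
  rw [← hx.eq_zero_iff i j, ← offset_sub_dotProduct_vertex, sub_eq_zero, mem_polygonEdge]
  have hmem : x i ∈ convexHull ℝ (Set.range x) := subset_convexHull ℝ _ (Set.mem_range_self i)
  constructor
  · rintro ⟨-, h⟩; exact h.symm
  · intro h; exact ⟨hmem, h.symm⟩

/-- **Edges are extreme** (exposed faces of the valid inequality `a_jᵀ y ≤ b_j`), convex and
nonempty. [cite: FioriniRothvossTiwary2012, §1 (p03, "each face of `P` is the projection of a face of the extension")] -/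
theorem IsConvexPolygon.isExtreme_edge (hx : IsConvexPolygon x) (hn : 2 ≤ n) (j : Fin (n + 1)) :
    (polygonEdge x j).Nonempty ∧ Convex ℝ (polygonEdge x j) ∧
      IsExtreme ℝ (convexHull ℝ (Set.range x)) (polygonEdge x j) := by
  have hP := hx.convexHull_eq (by omega)
  have hvalid : ∀ y ∈ convexHull ℝ (Set.range x), polygonNormal x j ⬝ᵥ y ≤ polygonOffset x j := by
    intro y hy; rw [hP] at hy; exact hy j
  refine ⟨⟨x j, (hx.vertex_mem_polygonEdge_iff j j).2 (Or.inl rfl)⟩, ?_, ?_⟩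
  · intro y₁ hy₁ y₂ hy₂ α β hα hβ hαβ
    refine ⟨(convex_convexHull ℝ _) hy₁.1 hy₂.1 hα hβ hαβ, ?_⟩
    show polygonNormal x j ⬝ᵥ (α • y₁ + β • y₂) = polygonOffset x j
    rw [dotProduct_add, dotProduct_smul, dotProduct_smul, smul_eq_mul, smul_eq_mul, hy₁.2, hy₂.2,
      ← add_mul, hαβ, one_mul]
  · refine ⟨fun y hy => hy.1, fun p hp q hq y hy hseg => ?_⟩
    obtain ⟨α, β, hα, hβ, hαβ, rfl⟩ := hseg
    have hp' := hvalid p hp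
    have hq' := hvalid q hq
    have hy2 : polygonNormal x j ⬝ᵥ (α • p + β • q) = polygonOffset x j := hy.2
    rw [dotProduct_add, dotProduct_smul, dotProduct_smul, smul_eq_mul, smul_eq_mul] at hy2
    have h1 : 0 ≤ α * (polygonOffset x j - polygonNormal x j ⬝ᵥ p) := mul_nonneg hα.le (by linarith)
    have h2 : 0 ≤ β * (polygonOffset x j - polygonNormal x j ⬝ᵥ q) := mul_nonneg hβ.le (by linarith)
    have hsum : α * (polygonOffset x j - polygonNormal x j ⬝ᵥ p) +
        β * (polygonOffset x j - polygonNormal x j ⬝ᵥ q) = 0 := by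
      have : (α + β) * polygonOffset x j = polygonOffset x j := by rw [hαβ, one_mul]
      linarith
    have h1' : α * (polygonOffset x j - polygonNormal x j ⬝ᵥ p) = 0 := by linarith
    have h2' : β * (polygonOffset x j - polygonNormal x j ⬝ᵥ q) = 0 := by linarith
    rcases mul_eq_zero.1 h1' with h | h
    · exact absurd h hα.ne'
    rcases mul_eq_zero.1 h2' with h' | h'
    · exact absurd h' hβ.ne'
    exact mem_polygonEdge.2 ⟨hp, by linarith⟩

/-- **A convex `m`-gon has at least `2m + 1` nonempty faces**: its `m` vertices, its `m` edges and
itself are pairwise distinct nonempty convex extreme subsets. [cite: FioriniRothvossTiwary2012, §1 (p03, "if `P` has `f` faces … `log₂(2n+2)`")] -/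
theorem IsConvexPolygon.two_mul_add_one_le_natCard_faces (hx : IsConvexPolygon x) (hn : 2 ≤ n)
    (hfin : Finite {F : Set (Fin 2 → ℝ) // F.Nonempty ∧ Convex ℝ F ∧
      IsExtreme ℝ (convexHull ℝ (Set.range x)) F}) :
    2 * (n + 1) + 1 ≤ Nat.card {F : Set (Fin 2 → ℝ) // F.Nonempty ∧ Convex ℝ F ∧
      IsExtreme ℝ (convexHull ℝ (Set.range x)) F} := by
  classical
  haveI := hfin
  set P := convexHull ℝ (Set.range x) with hPdef
  have hinj := hx.injective hn
  have hvP : ∀ i, x i ∈ P := fun i => subset_convexHull ℝ _ (Set.mem_range_self i)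
  -- the three kinds of faces
  let f : Fin (n + 1) ⊕ Fin (n + 1) ⊕ Unit →
      {F : Set (Fin 2 → ℝ) // F.Nonempty ∧ Convex ℝ F ∧ IsExtreme ℝ P F} := fun s =>
    match s with
    | Sum.inl i => ⟨{x i}, Set.singleton_nonempty _, convex_singleton _,
        isExtreme_singleton.2 (hx.mem_extremePoints hn i)⟩
    | Sum.inr (Sum.inl j) => ⟨polygonEdge x j, hx.isExtreme_edge hn j⟩
    | Sum.inr (Sum.inr _) => ⟨P, ⟨x 0, hvP 0⟩,
        convex_convexHull ℝ _, IsExtreme.rfl⟩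
  -- vertex memberships distinguishing the faces
  have hE := hx.vertex_mem_polygonEdge_iff
  have h1 := add_one_ne (by omega : 1 ≤ n)
  have h2 := add_two_ne hn
  have hf : Function.Injective f := by
    rintro (i | j | u) (i' | j' | u') h <;> simp only [f, Subtype.mk.injEq] at h
    · have hii : i = i' := hinj (Set.singleton_eq_singleton_iff.1 h)
      rw [hii]
    · -- `{x i} = edge j'`: the edge has two vertices
      exfalso
      have ha : x j' ∈ ({x i} : Set _) := by rw [h]; exact (hE j' j').2 (Or.inl rfl)
      have hb : x (j' + 1) ∈ ({x i} : Set _) := by rw [h]; exact (hE (j' + 1) j').2 (Or.inr rfl)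
      rw [Set.mem_singleton_iff] at ha hb
      exact h1 j' (hinj (hb.trans ha.symm))
    · exfalso
      have : x (i + 1) ∈ ({x i} : Set _) := by rw [h]; exact hvP _
      exact h1 i (hinj (Set.mem_singleton_iff.1 this))
    · exfalso
      have ha : x j ∈ ({x i'} : Set _) := by rw [← h]; exact (hE j j).2 (Or.inl rfl)
      have hb : x (j + 1) ∈ ({x i'} : Set _) := by rw [← h]; exact (hE (j + 1) j).2 (Or.inr rfl)
      rw [Set.mem_singleton_iff] at ha hb
      exact h1 j (hinj (hb.trans ha.symm))
    · -- `edge j = edge j'`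
      have ha : x j ∈ polygonEdge x j' := by rw [← h]; exact (hE j j).2 (Or.inl rfl)
      have hb : x (j + 1) ∈ polygonEdge x j' := by rw [← h]; exact (hE (j + 1) j).2 (Or.inr rfl)
      rw [hE] at ha hb
      rcases ha with ha | ha
      · rw [ha]
      · rcases hb with hb | hb
        · exfalso; rw [ha] at hb; exact h2 j' hb
        · have hjj : j = j' := add_right_cancel hb
          rw [hjj]
    · exfalso
      have : x (j + 1 + 1) ∈ polygonEdge x j := by rw [h]; exact hvP _
      rw [hE] at this
      rcases this with h3 | h3
      · exact h2 j h3
      · exact h1 (j + 1) h3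
    · exfalso
      have : x (i' + 1) ∈ ({x i'} : Set _) := by rw [← h]; exact hvP _
      exact h1 i' (hinj (Set.mem_singleton_iff.1 this))
    · exfalso
      have : x (j' + 1 + 1) ∈ polygonEdge x j' := by rw [← h]; exact hvP _
      rw [hE] at this
      rcases this with h3 | h3
      · exact h2 j' h3
      · exact h1 (j' + 1) h3
    · rfl
  calc 2 * (n + 1) + 1 = Nat.card (Fin (n + 1) ⊕ Fin (n + 1) ⊕ Unit) := by
        rw [Nat.card_eq_fintype_card]; simp [Fintype.card_sum]; ring
    _ ≤ _ := Nat.card_le_card_of_injective f hf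

/-- **FRT 2012 §1: `xc(P) ≥ log₂(2n+2)` for every convex `n`-gon.** If a convex `m`-gon (`m ≥ 3`)
has a slack-form extended formulation with `r` inequalities then `2m + 2 ≤ 2^r` (Goemans' face
count `f(P) ≤ 2^{t(Q)}` with `f = 2m + 2`; here `2m + 1` nonempty faces `≤ 2^r`, and `2^r` is even).
[cite: FioriniRothvossTiwary2012, §1 (p03)] -/
theorem IsConvexPolygon.two_mul_add_two_le_two_pow (hx : IsConvexPolygon x) (hn : 2 ≤ n) {r : ℕ}
    (h : HasEFOfSize (convexHull ℝ (Set.range x)) r) : 2 * (n + 1) + 2 ≤ 2 ^ r := by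
  have hle := (hx.two_mul_add_one_le_natCard_faces hn h.finite_faces).trans h.natCard_faces_le
  rcases Nat.eq_zero_or_pos r with hr | hr
  · subst hr; simp at hle
  · have : 2 ^ r = 2 * 2 ^ (r - 1) := by
      rw [← pow_succ']; congr 1; omega
    omega

/-- **Logarithmic form**: `log₂(2m+2) ≤ r` for every convex `m`-gon (`m ≥ 3`) with an EF of size
`r` ("`xc(P) ≥ log₂(2n+2) = Ω(log n)`"). [cite: FioriniRothvossTiwary2012, §1 (p03)] -/
theorem FioriniRothvossTiwary2012_xc_ge_logb (hx : IsConvexPolygon x) (hn : 2 ≤ n) {r : ℕ}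
    (h : HasEFOfSize (convexHull ℝ (Set.range x)) r) :
    Real.logb 2 (2 * ((n : ℝ) + 1) + 2) ≤ r := by
  have hnat := hx.two_mul_add_two_le_two_pow hn h
  have hle : (2 * ((n : ℝ) + 1) + 2) ≤ (2 : ℝ) ^ (r : ℝ) := by
    rw [Real.rpow_natCast]; exact_mod_cast hnat
  exact (Real.logb_le_iff_le_rpow one_lt_two (by positivity)).2 hle

end Literature.Combinatorics.Optimization

end
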